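import Summits.BirchSwinnertonDyer.BirchSwinnertonDyer.Theses.EisensteinPrimes
import Summits.BirchSwinnertonDyer.BirchSwinnertonDyer.Theorems.EisensteinPrimesMazurMCOnCellBMuPartTightParity
import Summits.BirchSwinnertonDyer.BirchSwinnertonDyer.Theorems.EisensteinPrimesMazurMCOnCellBLocate
import Summits.BirchSwinnertonDyer.Rank1Residual.X2.IsogenyClassStability
import Summits.BirchSwinnertonDyer.Rank1Residual.X2.RankOneHeegnerExact
import Literature.NumberTheory.EllipticCurves.TateCurve.NumberFieldUniformization
import Literature.NumberTheory.EllipticCurves.TateCurve.NumberFieldUniformizationTwisted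
import HarnessLib

/-!
# Crux `MazurMCOnCellB` (stmt-BirchSwinnertonDyer-19033), line `mudescent`, skeleton v4: the WEAK
# CURRENCY — Mazur's main conjecture at an X2b pair ⟺ μ-part ∧ λ-count with parity slack and NO
# parity conjunct; the crux BY NAME ⟺ the two v4 stubs at every X2b étale end (helper; closes nothing)

Cell `bsd-eis`, LEAD seat `bsd-line-x2-p1` (gen 2) on crux 3 (row A10, X2b). Skeleton of record since
this seat's reshape: `Cruxes/MazurMCOnCellB/Lines/mudescent.lean` **v4** (sha256 `460ece00…`), stubs
`stub_publishedInputs` [FACT], `stub_prop310` [FACT], `stub_muPart_offLocus` [OPEN],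
`stub_lambdaCountWeak_offLocus` [OPEN]. This file is the tree record of the reshape: it puts the v4
currency next to the v2 currency (`…MuPartTight` §3: slack `e`, no parity) and the v3 currency
(`…MuPartTightParity`: slack `e + 1` WITH the parity conjuncts `Even n` / `Odd n`) of the width seat
`bsd-line-x2-p1-w2` g2, and proves that v4 composes to the crux and is implied by it. Imports: the
route file directly (it speaks of the crux and of `PublishedInputs` BY NAME) and otherwise only
route-independent modules (no theses-cone chain through `…MuPartTightCrux`).

THE POINT. In the v3 currency the λ-stub carried `Even n` (non-split) / `Odd n` (split) for the
certified `λ_an = n`. For the TYPED datum this parity is a KERNEL THEOREM: the functional equation of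
THE Mazur–Tate–Teitelbaum `p`-adic `L`-function at `p ‖ N` gives `λ_an ≡ r_an + e (mod 2)`
(`X2.analyticLambdaEq_parity`, tree file `Rank1Residual/X2/LambdaParity.lean`; it needs an integral
`G` with `ι(G) = ϖ·L` — Wuthrich 2014 Thm. 16 — and SOME μ-certificate `X2.AnalyticMuLE W p m`, which
exists at `r_an = 0` by `…X2AnalyticMuBound.exists_analyticMuLE_of_analyticRank_eq_zero`), and
`r_an = 0` on X2b. So the parity conjuncts are dischargeable and the v4 λ-stub drops them:

* §1 `cellB_mazurMainConjectureAt_iff_muPart_and_lambdaCountWeak` — AT AN X2b PAIR: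
  `X2.MazurMainConjectureAt W p ⟺ μ-part(W, p) ∧ ∃ n k, λ_an = n ∧ λ_alg ≥ k ∧ (¬split → n ≤ k + 1) ∧
  (split → n ≤ k + 2)`, granted Wuthrich Thm. 16, Greenberg Prop. 3.10, GZK, modularity,
  Greenberg–Stevens (all by name). `→`: the v3 iff, conjuncts dropped; `←`: non-vanishing + kernel
  parity + the μ-tolerant parity route T `mazurMainConjectureAt_of_muPart_of_lambdaCountParity`.
* §1 `cellB_lambdaCountWeak_iff_lambdaCountParity` — at an X2b pair the v3 and v4 λ-currencies are
  EQUIVALENT granted Wuthrich + modularity + Greenberg–Stevens (the cut removes a proof obligation from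
  the stub, not content).
* §2 `mazurMCOnCellB_of_muPart_offLocus_of_lambdaCountWeak_offLocus` — the REGISTERED v4 composition
  as a tree theorem: stub 1 ∧ stub 1b ∧ stub 3′ ∧ stub 4″ ⇒ `EisensteinPrimes.MazurMCOnCellB` BY NAME
  (DESCEND `stub_locate` p443911, `X2.CellB` transport, §1 at the étale end, ASCEND
  `X2.mazurMainConjectureAt_of_isIsogenous`). When the two open stubs land (with these signatures) the
  closing file of the crux is this theorem applied to them.
* §2 `mazurMCOnCellB_iff_forall_offLocus_weak` — granted `PublishedInputs` and Prop. 3.10: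
  crux ⟺ ∀ X2b étale ends `(W₀, p)`, stub 3′(W₀, p) ∧ stub 4″(W₀, p). The v4 skeleton is EQUIVALENT
  to the crux: no surplus (v2 had Greenberg's Conj. 1.11 inside stub 3, v3 the parity conjuncts
  inside stub 4).

HONEST FRAMING: theorems only (no `def`, no named fact, no `sorry`); nothing here proves a stub, the
crux, Greenberg's conjecture or BSD for any curve; both open stubs remain OPEN class-wide (they are,
jointly, Mazur's main conjecture at the X2b étale ends: its reverse μ-inequality and its reverse
λ-inequality with slack); 0 cells / 0 labels move. References: [MazurTateTeitelbaum1986Invent]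
§I.17–I.18; [GreenbergLNM1716] Prop. 3.10 (p. 82), Conj. 1.11 (p. 58), Cor. 5.6 (p. 111);
[Wuthrich2014] Thm. 16 and Lemma 17 (p. 397); [GreenbergVatsal2000] p. 2 (1)–(2), p. 4–5, §1 p. 15;
[PerrinRiou1989Isogenie] Théorème (p. 349).
-/

set_option autoImplicit false

-- `Summit.BirchSwinnertonDyer.BirchSwinnertonDyer.…`: the summit and its single sub-problem share a name (D-0017 layout).
set_option linter.dupNamespace false

noncomputable section

open scoped Classical MatrixGroups ModularForm

open PowerSeries CongruenceSubgroup WeierstrassCurve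
  Literature.NumberTheory.EllipticCurves
  Literature.NumberTheory.EllipticCurves.ModularForms
  Literature.NumberTheory.EllipticCurves.Rank1Residual
  Literature.NumberTheory.EllipticCurves.Wuthrich2014
  Literature.NumberTheory.EllipticCurves.Greenberg1999
  Summit.BirchSwinnertonDyer.Rank1Residual
  Summit.BirchSwinnertonDyer.Rank1Residual.X1.MuLambda
  Summit.BirchSwinnertonDyer.Rank1Residual.X1.TamagawaSqueeze
  Summit.BirchSwinnertonDyer.BirchSwinnertonDyer.Theses
  Summit.BirchSwinnertonDyer.BirchSwinnertonDyer.Theorems.EisensteinPrimesX2AnalyticMuBound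
  Summit.BirchSwinnertonDyer.BirchSwinnertonDyer.Theorems.EisensteinPrimesMazurMCOnCellBMuPartTight
  Summit.BirchSwinnertonDyer.BirchSwinnertonDyer.Theorems.EisensteinPrimesMazurMCOnCellBMuPartTightParity

open Literature.Barriers.BirchSwinnertonDyer (HasRamifiedOddLineAt)

namespace Summit.BirchSwinnertonDyer.BirchSwinnertonDyer.Theorems.EisensteinPrimesMazurMCOnCellBMudescentV4

variable {W : WeierstrassCurve ℚ} [W.IsElliptic] [W.IsGloballyMinimal] {p : ℕ} [Fact p.Prime]

/-! ## §1. At an X2b pair: the weak currency -/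

/-- **At an X2b pair the v3 and v4 λ-currencies agree.** For `X2.CellB W p`, granted Wuthrich 2014
Thm. 16 (`hWu`, an integral `G` with `ι(G) = ϖ·L`), modularity (`hpar`) and Greenberg–Stevens (`hGS`,
for the non-vanishing of THE Mazur–Tate–Teitelbaum function at `r_an = 0`):
`(∃ n k, λ_an = n ∧ λ_alg ≥ k ∧ (¬split → n ≤ k+1) ∧ (split → n ≤ k+2)) ⟺
 (∃ n k, λ_an = n ∧ λ_alg ≥ k ∧ (¬split → n ≤ k+1 ∧ Even n) ∧ (split → n ≤ k+2 ∧ Odd n))` — the parity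
of a certified `λ_an = n` is `r_an + e = e (mod 2)` by the functional equation at `p ‖ N`
(`X2.analyticLambdaEq_parity`). [cite: MazurTateTeitelbaum1986Invent, §I.17–I.18] [cite: Wuthrich2014, Thm. 16 (p. 397)] -/
theorem cellB_lambdaCountWeak_iff_lambdaCountParity
    (hWu : thm16_charIdeal_dvd_multiplicative_of_reducible)
    (hpar : nonempty_modularParametrizationData) (hGS : greenberg_stevens (W := W) (p := p))
    (hc : X2.CellB W p) :
    (∃ n k : ℕ, X2.AnalyticLambdaEq W p n ∧ AlgebraicLambdaGE W p k ∧
        (¬ W.HasSplitMultiplicativeReductionAtPrime p → n ≤ k + 1) ∧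
        (W.HasSplitMultiplicativeReductionAtPrime p → n ≤ k + 2)) ↔
      (∃ n k : ℕ, X2.AnalyticLambdaEq W p n ∧ AlgebraicLambdaGE W p k ∧
        (¬ W.HasSplitMultiplicativeReductionAtPrime p → n ≤ k + 1 ∧ Even n) ∧
        (W.HasSplitMultiplicativeReductionAtPrime p → n ≤ k + 2 ∧ Odd n)) := by
  have hp2 : p ≠ 2 := hc.2.1.1
  have hred : ¬ W.HasIrreducibleModPGaloisRep p := hc.2.1.2.1
  have hmult : W.HasMultiplicativeReductionAtPrime p := hc.2.1.2.2
  have hr : W.analyticRank = 0 := hc.1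
  refine ⟨fun ⟨n, k, hlam, halg, hkN, hkS⟩ ↦ ?_,
    fun ⟨n, k, hlam, halg, hkN, hkS⟩ ↦ ⟨n, k, hlam, halg, fun h ↦ (hkN h).1, fun h ↦ (hkS h).1⟩⟩
  obtain ⟨m, hμm⟩ := exists_analyticMuLE_of_analyticRank_eq_zero hpar hp2 hGS hr
  obtain ⟨hev, hodd⟩ := X2.analyticLambdaEq_parity hWu hpar W p hp2 hmult hred hμm hlam
  rw [hr, add_zero] at hev hodd
  exact ⟨n, k, hlam, halg, fun h ↦ ⟨hkN h, hev h⟩, fun h ↦ ⟨hkS h, hodd h⟩⟩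

/-- **On sub-cell X2b: Mazur's main conjecture at the pair ⟺ μ-part ∧ the WEAK λ-count** (slack
`e + 1`, no parity conjunct) — the v4 currency of line `mudescent`. Granted (by name) Wuthrich 2014
Thm. 16 (`hWu`), Greenberg 1999 Prop. 3.10 (`h310`), Gross–Zagier–Kolyvagin (`hGZK`), modularity
(`hpar`), Greenberg–Stevens (`hGS`). `→`: the v3 iff `cellB_mazurMainConjectureAt_iff_muPart_and_lambdaCountParity`
with the parity conjuncts dropped; `←`: the non-vanishing of THE `p`-adic `L`-function at `r_an = 0`,
the kernel parity `λ_an ≡ r_an + e` (`X2.analyticLambdaEq_parity`) and the μ-tolerant parity route T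
`mazurMainConjectureAt_of_muPart_of_lambdaCountParity`. [cite: GreenbergLNM1716, Prop. 3.10 (p. 82) and Cor. 5.6 (p. 111)]
[cite: Wuthrich2014, Thm. 16 (p. 397)] [cite: MazurTateTeitelbaum1986Invent, §I.17] -/
theorem cellB_mazurMainConjectureAt_iff_muPart_and_lambdaCountWeak
    (hWu : thm16_charIdeal_dvd_multiplicative_of_reducible)
    (h310 : prop310_selmerCorank_mod_two_eq_lambdaInvariant)
    (hGZK : rank_eq_analyticRank_of_analyticRank_le_one)
    (hpar : nonempty_modularParametrizationData) (hGS : greenberg_stevens (W := W) (p := p))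
    (hc : X2.CellB W p) :
    X2.MazurMainConjectureAt W p ↔
      ((∀ (κ : ZpExtension ℚ p) (γ : Field.absoluteGaloisGroup ℚ),
        κ.IsCyclotomic → κ.IsTopGenerator γ → IsCyclotomicVariable p γ →
        ∀ {N : ℕ} [NeZero N] (f : CuspForm (Gamma0 N) 2), IsNewformOf W f →
        ∀ (ϖ : ℚ), (ϖ : ℝ) * W.realPeriodRat = plusPeriod f →
        ∀ (L : PowerSeries ℚ_[p]),
          (W.HasSplitMultiplicativeReductionAtPrime p → IsSplitMultPAdicLFunctionOf f p L) →
          (¬ W.HasSplitMultiplicativeReductionAtPrime p → IsMultPAdicLFunctionOf f p (-1) L) →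
        ∀ (D : W.SelmerDualData κ γ) (g G : IwasawaAlgebra p), D.charIdeal = Ideal.span {g} →
          iwasawaToPowerSeries p G = PowerSeries.C ((ϖ : ℚ) : ℚ_[p]) * L → mu G ≤ mu g) ∧
      ∃ n k : ℕ, X2.AnalyticLambdaEq W p n ∧ AlgebraicLambdaGE W p k ∧
        (¬ W.HasSplitMultiplicativeReductionAtPrime p → n ≤ k + 1) ∧
        (W.HasSplitMultiplicativeReductionAtPrime p → n ≤ k + 2)) := by
  rw [cellB_mazurMainConjectureAt_iff_muPart_and_lambdaCountParity hWu h310 hGZK hpar hGS hc,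
    cellB_lambdaCountWeak_iff_lambdaCountParity hWu hpar hGS hc]

/-! ## §2. The crux BY NAME in the v4 currency -/

/-- **The registered v4 composition of line `mudescent` as a tree theorem.** Stub 1
(`EisensteinPrimes.PublishedInputs`) ∧ stub 1b (Greenberg Prop. 3.10) ∧ stub 3′ (the μ-part
`μ(G) ≤ μ(g)` for every cyclotomic datum at every X2b étale end) ∧ stub 4″ (the weak λ-count at every
X2b étale end) ⇒ the crux `EisensteinPrimes.MazurMCOnCellB` BY NAME: DESCEND to the étale end `W₀`
(`stub_locate`, LANDED p443911), transport `X2.CellB` (`X2.cellB_iff_of_isIsogenous`, Tate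
uniformisation facts discharged), §1 at `(W₀, p)`, ASCEND along `W₀ ∼ W`
(`X2.mazurMainConjectureAt_of_isIsogenous`: Wuthrich, Stein–Wuthrich + heights, GZK, modularity,
Cassels, Greenberg–Stevens). [cite: GreenbergLNM1716, Conj. 1.11 and p. 58 ([Sch3], [Pe2])]
[cite: PerrinRiou1989Isogenie, Théorème (p. 349)] [cite: Wuthrich2014, Thm. 16 and Lemma 17 (p. 397)] -/
theorem mazurMCOnCellB_of_muPart_offLocus_of_lambdaCountWeak_offLocus
    (hP : EisensteinPrimes.PublishedInputs)
    (h310 : prop310_selmerCorank_mod_two_eq_lambdaInvariant)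
    (hμ : ∀ (W₀ : WeierstrassCurve ℚ) [W₀.IsElliptic] [W₀.IsGloballyMinimal] (p : ℕ) [Fact p.Prime],
      X2.CellB W₀ p → ¬ HasRamifiedOddLineAt W₀ p →
      ∀ (κ : ZpExtension ℚ p) (γ : Field.absoluteGaloisGroup ℚ),
        κ.IsCyclotomic → κ.IsTopGenerator γ → IsCyclotomicVariable p γ →
        ∀ {N : ℕ} [NeZero N] (f : CuspForm (Gamma0 N) 2), IsNewformOf W₀ f →
        ∀ (ϖ : ℚ), (ϖ : ℝ) * W₀.realPeriodRat = plusPeriod f →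
        ∀ (L : PowerSeries ℚ_[p]),
          (W₀.HasSplitMultiplicativeReductionAtPrime p → IsSplitMultPAdicLFunctionOf f p L) →
          (¬ W₀.HasSplitMultiplicativeReductionAtPrime p → IsMultPAdicLFunctionOf f p (-1) L) →
        ∀ (D : W₀.SelmerDualData κ γ) (g G : IwasawaAlgebra p), D.charIdeal = Ideal.span {g} →
          iwasawaToPowerSeries p G = PowerSeries.C ((ϖ : ℚ) : ℚ_[p]) * L → mu G ≤ mu g)
    (hl : ∀ (W₀ : WeierstrassCurve ℚ) [W₀.IsElliptic] [W₀.IsGloballyMinimal] (p : ℕ) [Fact p.Prime],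
      X2.CellB W₀ p → ¬ HasRamifiedOddLineAt W₀ p →
        ∃ n k : ℕ, X2.AnalyticLambdaEq W₀ p n ∧ AlgebraicLambdaGE W₀ p k ∧
          (¬ W₀.HasSplitMultiplicativeReductionAtPrime p → n ≤ k + 1) ∧
          (W₀.HasSplitMultiplicativeReductionAtPrime p → n ≤ k + 2)) :
    EisensteinPrimes.MazurMCOnCellB := by
  have hCassels := hP.2.1
  have hpar := hP.2.2.2.2.1
  have hnf := hP.2.2.2.2.2.1
  have hGZK := hP.2.2.2.2.2.2.2.2.2.2.1
  have hWu := hP.2.2.2.2.2.2.2.2.2.2.2.2.2.2.1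
  have hJs := hP.2.2.2.2.2.2.2.2.2.2.2.2.2.2.2.1
  have hJn := hP.2.2.2.2.2.2.2.2.2.2.2.2.2.2.2.2.1
  have hHs := hP.2.2.2.2.2.2.2.2.2.2.2.2.2.2.2.2.2.1
  have hHn := hP.2.2.2.2.2.2.2.2.2.2.2.2.2.2.2.2.2.2.1
  have hGS := hP.2.2.2.2.2.2.2.2.2.2.2.2.2.2.2.2.2.2.2
  unfold EisensteinPrimes.MazurMCOnCellB
  intro W _ _ p _ hc
  -- DESCEND
  obtain ⟨W₀, _, _, hiso, hoff⟩ := EisensteinPrimesMazurMCOnCellBLocate.stub_locate W p hc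
  have hc₀ : X2.CellB W₀ p :=
    (X2.cellB_iff_of_isIsogenous (p := p) TateCurve.Silverman1994_thmV53_tateUniformisation_holds
      TateCurve.Silverman1994_thmV53_corV54_tateUniformisation_holds hiso).mp hc
  have hp2 : p ≠ 2 := hc₀.2.1.1
  have hred₀ : ¬ W₀.HasIrreducibleModPGaloisRep p := hc₀.2.1.2.1
  have hmult₀ : W₀.HasMultiplicativeReductionAtPrime p := hc₀.2.1.2.2
  have hr₀ : W₀.analyticRank = 0 := hc₀.1
  -- the v4 stubs at the étale end give MC at `(W₀, p)` (§1)
  have hMC₀ : X2.MazurMainConjectureAt W₀ p :=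
    (cellB_mazurMainConjectureAt_iff_muPart_and_lambdaCountWeak hWu h310 hGZK hpar (hGS W₀ p) hc₀).mpr
      ⟨hμ W₀ p hc₀ hoff, hl W₀ p hc₀ hoff⟩
  -- ASCEND along `W₀ ∼ W`
  exact X2.mazurMainConjectureAt_of_isIsogenous hWu hJs hJn hHs hHn hGZK hnf hpar hCassels hGS
    hiso.symm_of_charZero p hp2 hmult₀ hred₀ hr₀ hMC₀

/-- **The crux, TIGHT, in the shape of skeleton v4 (every X2b étale end, WEAK λ-count).** Granted
`PublishedInputs` and Greenberg 1999 Prop. 3.10: `MazurMCOnCellB ⟺ ∀ X2b pairs (W₀, p) OFF the locus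
`HasRamifiedOddLineAt`, stub 3′(W₀, p) ∧ stub 4″(W₀, p)` — the v4 skeleton of line `mudescent` is
EQUIVALENT to the crux. `→`: §1 at `W₀` itself (the v3 iff of `…MuPartTightCrux` with the parity
conjuncts dropped); `←`: `mazurMCOnCellB_of_muPart_offLocus_of_lambdaCountWeak_offLocus`.
[cite: GreenbergLNM1716, Prop. 3.10 (p. 82), Conj. 1.11 (p. 58)] [cite: Wuthrich2014, Thm. 16 and Lemma 17 (p. 397)]
[cite: MazurTateTeitelbaum1986Invent, §I.17] -/
theorem mazurMCOnCellB_iff_forall_offLocus_weak (hP : EisensteinPrimes.PublishedInputs)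
    (h310 : prop310_selmerCorank_mod_two_eq_lambdaInvariant) :
    EisensteinPrimes.MazurMCOnCellB ↔
      ∀ (W₀ : WeierstrassCurve ℚ) [W₀.IsElliptic] [W₀.IsGloballyMinimal] (p : ℕ) [Fact p.Prime],
        X2.CellB W₀ p → ¬ HasRamifiedOddLineAt W₀ p →
        ((∀ (κ : ZpExtension ℚ p) (γ : Field.absoluteGaloisGroup ℚ),
          κ.IsCyclotomic → κ.IsTopGenerator γ → IsCyclotomicVariable p γ →
          ∀ {N : ℕ} [NeZero N] (f : CuspForm (Gamma0 N) 2), IsNewformOf W₀ f →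
          ∀ (ϖ : ℚ), (ϖ : ℝ) * W₀.realPeriodRat = plusPeriod f →
          ∀ (L : PowerSeries ℚ_[p]),
            (W₀.HasSplitMultiplicativeReductionAtPrime p → IsSplitMultPAdicLFunctionOf f p L) →
            (¬ W₀.HasSplitMultiplicativeReductionAtPrime p → IsMultPAdicLFunctionOf f p (-1) L) →
          ∀ (D : W₀.SelmerDualData κ γ) (g G : IwasawaAlgebra p), D.charIdeal = Ideal.span {g} →
            iwasawaToPowerSeries p G = PowerSeries.C ((ϖ : ℚ) : ℚ_[p]) * L → mu G ≤ mu g) ∧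
        ∃ n k : ℕ, X2.AnalyticLambdaEq W₀ p n ∧ AlgebraicLambdaGE W₀ p k ∧
          (¬ W₀.HasSplitMultiplicativeReductionAtPrime p → n ≤ k + 1) ∧
          (W₀.HasSplitMultiplicativeReductionAtPrime p → n ≤ k + 2)) := by
  have hpar := hP.2.2.2.2.1
  have hGZK := hP.2.2.2.2.2.2.2.2.2.2.1
  have hWu := hP.2.2.2.2.2.2.2.2.2.2.2.2.2.2.1
  have hGS := hP.2.2.2.2.2.2.2.2.2.2.2.2.2.2.2.2.2.2.2
  refine ⟨fun h W₀ _ _ p _ hc₀ _ ↦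
    (cellB_mazurMainConjectureAt_iff_muPart_and_lambdaCountWeak hWu h310 hGZK hpar (hGS W₀ p) hc₀).mp
      (by unfold EisensteinPrimes.MazurMCOnCellB at h; exact h W₀ p hc₀), fun h ↦ ?_⟩
  exact mazurMCOnCellB_of_muPart_offLocus_of_lambdaCountWeak_offLocus hP h310
    (fun W₀ _ _ p _ hc₀ hoff ↦ (h W₀ p hc₀ hoff).1) (fun W₀ _ _ p _ hc₀ hoff ↦ (h W₀ p hc₀ hoff).2)

end Summit.BirchSwinnertonDyer.BirchSwinnertonDyer.Theorems.EisensteinPrimesMazurMCOnCellBMudescentV4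

end
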